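import Summits.BirchSwinnertonDyer.Rank1Residual.X5.SelmerSolitaireQuadraticMoveExtension
import Summits.BirchSwinnertonDyer.Rank1Residual.X5.SelmerSolitaireQuadraticNormalForm
import Summits.BirchSwinnertonDyer.Rank1Residual.X5.SelmerSolitaireOnePrime
import HarnessLib

/-!
# Selmer solitaire, QUADRATIC-SPACE LAYER (ii‴) — Q8: the quadratic model inherits T4 (QS ∘ (ii′), AR-free)

Cell `b2b-bsdres`, O1 programme (p = 2), ORDER v2.9 pool slot (ii‴) (o1 lead GEN 20/21, R-G20.3/R-G20.4,
PLAN C150/C153); pool hand x11b3-p4 GEN 5. The first arrow of lens-2's composition 2G10.1 done INSIDE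
the kernel: QS1 (`normalForm_holds`, p2's Q3) ∘ QS1c (`coreTest_holds` / `coreQ_nfSpace_iff_core`, Q2)
∘ QS2b (`iota_nfVec_add_psiN_smul`, `uNew_not_mem_nfSpace`, Q4c) ∘ the GRAPH-LAYER theorem T4
(`exists_extend_chain`, p2's `X5.SelmerSolitaireOnePrime`). THEOREMS ONLY (no definition, no named
fact, no `sorry`).

HONEST FRAMING (cell, verbatim): research route; pure `𝔽₂` linear algebra — no curve, no Galois group,
no prime; the arithmetic reading (AR1–AR4: 'adjoining ONE Kolyvagin prime realising `ψ` connects `∅`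
to any core vertex off BAD₁') is NOT asserted here; reach-neutral (R1 closes no class); nothing booked;
no mark / label / count moved; O1 OPEN.

## What is proved
`indic_filter_eq` — an `𝔽₂`-valued neighbourhood function is the indicator of its support;
**`exists_move_core_chain`** — for a totally singular Lagrangian `U` of `Q_D` with `∅` core and a core
vertex `B` there are a linear functional `ψ`, THE forced Lagrangian `L` of `Q_{D ∪ q}` over `K′_ψ`
avoiding `u_q` (the `∃!` of QS2a `moveForced_holds`), and an ordering `b₁, …, b_d` of `B` such that
`{q}, {b₁, q}, …, B ∪ {q}` are all core for `L` — the model form of `OnePrimeConnection` (T4).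

## References
* lens-2 GEN 5 G5.3 T4, GEN 10 2G10.1 / 2G10.5 (`cells/o1/ROUTES-O1.md` l.1966–1988); B. Mazur,
  K. Rubin, Contemp. Math. 358 (2004), §5 (the graph `𝒳⁰`) [MazurRubin2004Intro].
* Tree: `normalForm_holds` (p2), `exists_extend_chain` (p2), `coreQ_nfSpace_iff_core`,
  `isTSLagrangian_nfSpace`, `mem_nfSpace_iff` (Q2), `iota_nfVec_add_psiN_smul`, `psiN_add`,
  `psiN_smul`, `uNew_not_mem_nfSpace` (Q4c). Dedup: `lean search 'exists_move_core_chain|indic_filter'` → none.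
-/

namespace Summit.BirchSwinnertonDyer.Rank1Residual.X5.SelmerSolitaire.Quadratic

open Finset Matrix SelmerSolitaire

variable {s : ℕ}

/-- Any `𝔽₂`-valued neighbourhood function is the indicator of its support. [folklore] -/
theorem indic_filter_eq (N : V s → ZMod 2) : indic (Finset.univ.filter fun v => N v = 1) = N := by
  funext v
  simp only [indic, Finset.mem_filter, Finset.mem_univ, true_and]
  rcases (by decide : ∀ c : ZMod 2, c = 0 ∨ c = 1) (N v) with h | h <;> simp [h]

/-- **The quadratic model inherits the ONE-PRIME CONNECTION (T4)**: for a totally singular Lagrangian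
`U` of `Q_D` with `∅` core and a core vertex `B`, there is a move — a linear functional `ψ` and THE
forced Lagrangian `L` of `Q_{D ∪ q}` over `K′_ψ` avoiding `u_q` (QS2a) — and an ordering
`b₁, …, b_d` of `B` such that `{q}, {b₁, q}, …, B ∪ {q}` are all core for `L`; so `∅ — q — b₁q — ⋯ — Bq — B`
is a path of cube-adjacent core vertices at level `D ∪ {q}`. Composition of QS1 (`normalForm_holds`),
QS1c (`coreTest_holds`), QS2b (`iota_nfVec_add_psiN_smul`, `uNew_not_mem_nfSpace`) with the graph-layer
theorem T4 (`exists_extend_chain`, p2). Pure linear algebra; the arithmetic reading (adjoining ONE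
Kolyvagin prime connects `∅` to any core vertex off BAD₁) is NOT asserted here. [cite: MazurRubin2004Intro, §5 (𝒳⁰)] -/
theorem exists_move_core_chain {U : Submodule (ZMod 2) (QVec s)}
    (hU : IsTSLagrangian U) (h0 : CoreQ U ∅) {B : Finset (Fin s)} (hB : CoreQ U B) :
    ∃ (ψ : QVec s →ₗ[ZMod 2] ZMod 2) (L : Submodule (ZMod 2) (QVec (s + 1))) (l : List (Fin s)),
      (IsTSLagrangian L ∧ kPrime U ψ ⊆ (L : Set (QVec (s + 1))) ∧ uNew s ∉ L) ∧
        l.Nodup ∧ l.toFinset = B ∧ ∀ i ≤ l.length, CoreQ L (withNew (l.take i).toFinset) := by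
  classical
  obtain ⟨P, b, rfl⟩ := normalForm_holds s U hU h0
  have hBc : Core P B := (coreQ_nfSpace_iff_core P b B).mp hB
  obtain ⟨N, -, -, l, hl, hlB, hchain⟩ := exists_extend_chain P B hBc (fun _ => 0)
  set Ns : Finset (V s) := Finset.univ.filter fun v => N v = 1 with hNs
  have hind : indic Ns = N := indic_filter_eq N
  let ψ : QVec s →ₗ[ZMod 2] ZMod 2 :=
    { toFun := psiN b Ns, map_add' := psiN_add b Ns, map_smul' := psiN_smul b Ns }
  refine ⟨ψ, nfSpace (extend P N) b, l, ⟨isTSLagrangian_nfSpace _ b, ?_, uNew_not_mem_nfSpace _ b⟩,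
    hl, hlB, fun i hi => (coreQ_nfSpace_iff_core _ b _).mpr (hchain i hi)⟩
  rintro _ ⟨x, hx, rfl⟩
  obtain ⟨ε, z, rfl⟩ := (mem_nfSpace_iff P b x).mp hx
  change iota (nfVec P b ε z) + psiN b Ns (nfVec P b ε z) • uNew s ∈ _
  rw [iota_nfVec_add_psiN_smul, hind]
  exact (mem_nfSpace_iff _ b _).mpr ⟨ε, Fin.snoc z 0, rfl⟩

end Summit.BirchSwinnertonDyer.Rank1Residual.X5.SelmerSolitaire.Quadratic
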